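import Literature.NumberTheory.GaloisRepresentations.IdeleClassBarBoundaryPairing
import Literature.NumberTheory.GaloisRepresentations.PresentationOfFiniteGaloisModule
import Literature.NumberTheory.GaloisRepresentations.GalLayerSystemSES
import HarnessLib

/-!
# The E-side of (R4) FOR THE CANONICAL PRESENTATION: `inv_K(ŷ ∘ ∂_{C̄}(f ≫ (J̄ → C̄)))` is a finite-layer `inv_{E/K}` at
# every layer `E ⊇ K(M)` carrying `ŷ` (Milne ADT I Thm. 4.10, proof; Tate C–F VII §11.2 (bis))

Topic `NumberTheory/GaloisRepresentations`; namespace `Literature.NumberTheory.GaloisRepresentations.FreePresentation`.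
Sequel to door-c4 g17's `IdeleClassBarBoundaryPairing.lean` (`classBarInv_inflG_comp_boundary_eq_classInvAll`,
`exists_layer_inflG_eq`) and `DiscreteRepLayerBoundary.lean` (`shortExact_map_invariantsQuotFunctor`), door-c6 g16's
`PresentationOfFiniteGaloisModule.lean` (`presentationComplex ρ : 0 → N₁ → presLattice (K(M)) |M| → M → 0`,
`trivialOn_presLattice`) and door-c5 g16's `GalLayerSystemSES.lean` (`ideleClassLimitShortComplex K : 0 → F̄ˣ → J̄ → C̄ → 0`,
`X₃ = classBarD K` definitionally).  Theorems only (no definition, no named fact, no instance, no notation, no `sorry`).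

THE POINT.  Hypothesis (R4) of door-c6 g16's F8 skeleton `middleExact_allPlaces_of_readout` (Summits,
`…PoitouTatePresentationRoad`; `hα` now discharged, `…PresentationRoadAlpha`) asks, for `f : N₁ → J̄` and
`ŷ ∈ Ext¹_{C_Γ}(ℤ, N)`, for the value `classBarInv K (ŷ ∘ ∂_{C̄}(f ≫ (J̄ → C̄)))`.  For the canonical presentation
`S = presentationComplex ρ` of a finite `M` (layer `K(M) = presentationLayer ρ`):

* `presentationComplex_map_invariantsQuotFunctor_shortExact` — the layer sequence `S^{U_E} : 0 → N₁^{U_E} → P^{U_E} → M^{U_E} → 0`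
  is SHORT EXACT at every layer `E ⊇ K(M)` (`U_E ≤ U_{K(M)}` acts trivially on `P = Inf ℤ[Γ/U_{K(M)}]ᵐ`);
* `exists_layer_ge_inflG_eq` — every `ŷ ∈ Extⁿ_{C_Γ}(ℤ, X)` is `Inf_E c` for some layer `E ⊇ L` above any given layer `L`
  (door-c4 (d) + `inflG_stepG`);
* **`classBarInv_inflG_comp_boundary_presentation`** — for `E ⊇ K(M)`, `c ∈ H¹(Γ_K ⧸ U_E, M^{U_E})` and `f : N₁ → J̄`:
  `classBarInv K (Inf_E c ∘ ∂_{C̄}(f ≫ g)) = inv_{E/K}(iso_E ((f ≫ g)^{U_E}_* (δ_{S^{U_E}} c)))` (`g : J̄ → C̄`,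
  `inv_{E/K} = IdeleCohomology.classInvAll K E`, `iso_E = layerCohomologyIso E 2`);
* **`exists_layer_classBarInv_comp_boundary_eq`** — hence for EVERY `ŷ` there are `E ⊇ K(M)` and `c` with `ŷ = Inf_E c` and that
  value formula — the finite-layer starting point of the (R4) computation `inv_{E/K}((g_E f_E)_* δ c) = Σ_v inv_v(…)`
  (FINDING-door-c6-g16 §2; door-c5's F7-dict (i), `functor_map_comp_layerCohomologyIso`).

HONEST FRAMING: bookkeeping; no arithmetic beyond the definitions, no case of BSD or of Poitou–Tate.  Route A (R4, E-side) of crux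
`AnticycControlAdditiveK` (item 19295, cell bsd-schneider), seat door-c4 gen 17.

## References
* J. S. Milne, *Arithmetic Duality Theorems* (2nd ed. 2006), I §4, proof of Theorem 4.10 (p. 58); I Lemma 1.9 (proof). [MilneADT2006]
* J. W. S. Cassels, A. Fröhlich (eds.), *Algebraic Number Theory* (1967), Ch. VII (J. Tate) §11.2 (bis). [CasselsFrohlichANT1967]
* J.-P. Serre, *Galois Cohomology* (1997), I §2.2 Proposition 8. [SerreGaloisCohomology1997]
-/

noncomputable section

open NumberField CategoryTheory CategoryTheory.Abelian groupCohomology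
open Field (absoluteGaloisGroup)
open Literature.Algebra.Homology Literature.Algebra.Homology.DiscreteRep
open scoped Classical

namespace Literature.NumberTheory.GaloisRepresentations

open IdeleClassBar

namespace FreePresentation

variable {K : Type} [Field K] [NumberField K]

/-! ## §1 Every class is inflated from a layer above a given one -/

/-- **Every `ŷ ∈ Extⁿ_{C_Γ}(ℤ, X)` is `Inf_E c` for some layer `E ⊇ L`**, for any given layer `L` (door-c4 (d)
`exists_layer_inflG_eq`, then the compositum `L ⊔ E` and `inflG_stepG`). [cite: SerreGaloisCohomology1997, I §2.2 Proposition 8] -/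
theorem exists_layer_ge_inflG_eq [CompactSpace (absoluteGaloisGroup K)] [TotallyDisconnectedSpace (absoluteGaloisGroup K)]
    (L : GalLayer K) (X : DiscreteRepCat ℤ (absoluteGaloisGroup K)) (n : ℕ)
    (y : Ext (triv (k := ℤ) (Γ := absoluteGaloisGroup K) ℤ) X n) :
    ∃ (E : GalLayer K) (_ : L ≤ E) (c : groupCohomology
      ((invariantsQuotFunctor ℤ (E.openNormalSubgroup : Subgroup (absoluteGaloisGroup K))).obj X) n),
      LayerColimit.inflG E.openNormalSubgroup X n c = y := by
  obtain ⟨E, c, rfl⟩ := exists_layer_inflG_eq X n y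
  obtain ⟨E', hLE', hEE'⟩ := GalLayer.exists_ge_ge L E
  exact ⟨E', hLE', LayerColimit.stepG E.openNormalSubgroup E'.openNormalSubgroup (GalLayer.coe_openNormalSubgroup_le hEE') X n c,
    LayerColimit.inflG_stepG E.openNormalSubgroup E'.openNormalSubgroup (GalLayer.coe_openNormalSubgroup_le hEE') X n c⟩

/-! ## §2 The layer sequences of the canonical presentation are short exact -/

variable {M : Type} [AddCommGroup M] [TopologicalSpace M] [DiscreteTopology M] [Finite M]
  (ρ : DiscreteGaloisModule K M)

/-- **`S^{U_E} : 0 → N₁^{U_E} → P^{U_E} → M^{U_E} → 0` is short exact for every layer `E ⊇ K(M)`** (`S = presentationComplex ρ`;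
`U_E ≤ U_{K(M)}` acts trivially on `P = presLattice (K(M)) |M|`, door-c6 `trivialOn_presLattice`; door-c4 g17
`shortExact_map_invariantsQuotFunctor`). [cite: MilneADT2006, I Lemma 1.9 (proof)] -/
theorem presentationComplex_map_invariantsQuotFunctor_shortExact {E : GalLayer K} (h : presentationLayer ρ ≤ E) :
    ((presentationComplex ρ).map
      (invariantsQuotFunctor ℤ (E.openNormalSubgroup : Subgroup (absoluteGaloisGroup K)))).ShortExact :=
  shortExact_map_invariantsQuotFunctor (E.openNormalSubgroup : Subgroup (absoluteGaloisGroup K))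
    (presentationComplex_shortExact ρ) fun u x =>
      (trivialOn_presLattice (presentationLayer ρ) (presentationRank ρ)).mono h u.1 u.2 x

/-! ## §3 `inv_K(Inf_E c ∘ ∂_{C̄}(f ≫ g))` for the canonical presentation -/

variable [CompactSpace (absoluteGaloisGroup K)] [TotallyDisconnectedSpace (absoluteGaloisGroup K)]

/-- **`classBarInv K (Inf_E c ∘ ∂_{C̄}(f ≫ g)) = inv_{E/K}(iso_E ((f ≫ g)^{U_E}_* (δ_{S^{U_E}} c)))`** for the canonical
presentation `S = presentationComplex ρ`, a layer `E ⊇ K(M)`, `c ∈ H¹(Γ_K ⧸ U_E, M^{U_E})` and `f : N₁ → J̄`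
(`g : J̄ → C̄` = `(ideleClassLimitShortComplex K).g`; `X₃ = classBarD K` definitionally).
[cite: MilneADT2006, I §4, proof of Theorem 4.10][cite: CasselsFrohlichANT1967, Ch. VII §11.2 (bis)] -/
theorem classBarInv_inflG_comp_boundary_presentation {E : GalLayer K} (h : presentationLayer ρ ≤ E)
    (c : groupCohomology ((invariantsQuotFunctor ℤ (E.openNormalSubgroup : Subgroup (absoluteGaloisGroup K))).obj
      (presentationComplex ρ).X₃) 1)
    (f : (presentationComplex ρ).X₁ ⟶ (ideleClassLimitShortComplex K).X₂) :
    classBarInv K ((LayerColimit.inflG E.openNormalSubgroup (presentationComplex ρ).X₃ 1 c).comp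
        (ExtPresentation.boundary (presentationComplex_shortExact ρ) (classBarD K)
          (f ≫ (ideleClassLimitShortComplex K).g)) (rfl : 1 + 1 = 2)) =
      (haveI := E.numberField; haveI := E.isGalois;
        IdeleCohomology.classInvAll K E.1 ((layerCohomologyIso E 2).hom
          ((groupCohomology.map (MonoidHom.id _)
            ((invariantsQuotFunctor ℤ (E.openNormalSubgroup : Subgroup (absoluteGaloisGroup K))).map
              (f ≫ (ideleClassLimitShortComplex K).g)) 2).hom
            ((groupCohomology.δ (presentationComplex_map_invariantsQuotFunctor_shortExact ρ h) 1 2 rfl).hom c)))) :=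
  classBarInv_inflG_comp_boundary_eq_classInvAll E (presentationComplex_shortExact ρ)
    (presentationComplex_map_invariantsQuotFunctor_shortExact ρ h) c _

/-- **For EVERY `ŷ ∈ Ext¹_{C_Γ}(ℤ, M)` and `f : N₁ → J̄`: a layer `E ⊇ K(M)` and `c ∈ H¹(Γ_K ⧸ U_E, M^{U_E})` with `ŷ = Inf_E c`
and `classBarInv K (ŷ ∘ ∂_{C̄}(f ≫ g)) = inv_{E/K}(iso_E ((f ≫ g)^{U_E}_* (δ_{S^{U_E}} c)))`** — the E-side input of (R4) for
the canonical presentation. [cite: MilneADT2006, I §4, proof of Theorem 4.10][cite: CasselsFrohlichANT1967, Ch. VII §11.2 (bis)] -/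
theorem exists_layer_classBarInv_comp_boundary_eq
    (ŷ : Ext (triv (k := ℤ) (Γ := absoluteGaloisGroup K) ℤ) (presentationComplex ρ).X₃ 1)
    (f : (presentationComplex ρ).X₁ ⟶ (ideleClassLimitShortComplex K).X₂) :
    ∃ (E : GalLayer K) (h : presentationLayer ρ ≤ E) (c : groupCohomology
      ((invariantsQuotFunctor ℤ (E.openNormalSubgroup : Subgroup (absoluteGaloisGroup K))).obj
        (presentationComplex ρ).X₃) 1),
      LayerColimit.inflG E.openNormalSubgroup (presentationComplex ρ).X₃ 1 c = ŷ ∧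
      classBarInv K (ŷ.comp (ExtPresentation.boundary (presentationComplex_shortExact ρ) (classBarD K)
          (f ≫ (ideleClassLimitShortComplex K).g)) (rfl : 1 + 1 = 2)) =
        (haveI := E.numberField; haveI := E.isGalois;
          IdeleCohomology.classInvAll K E.1 ((layerCohomologyIso E 2).hom
            ((groupCohomology.map (MonoidHom.id _)
              ((invariantsQuotFunctor ℤ (E.openNormalSubgroup : Subgroup (absoluteGaloisGroup K))).map
                (f ≫ (ideleClassLimitShortComplex K).g)) 2).hom
              ((groupCohomology.δ (presentationComplex_map_invariantsQuotFunctor_shortExact ρ h) 1 2 rfl).hom c)))) := by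
  obtain ⟨E, h, c, rfl⟩ := exists_layer_ge_inflG_eq (presentationLayer ρ) (presentationComplex ρ).X₃ 1 ŷ
  exact ⟨E, h, c, rfl, classBarInv_inflG_comp_boundary_presentation ρ h c f⟩

end FreePresentation

end Literature.NumberTheory.GaloisRepresentations

end
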